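import Mathlib
import HarnessLib
import Summits.HubbardSuperconductivity.HubbardSuperconductivity.Theorems.KLProgrammeKLRegimeTwoVolumeLipDiffDefs
import Summits.HubbardSuperconductivity.HubbardSuperconductivity.Theorems.KLProgrammeKLRegimeTwoVolumeLipZoneGeometry

/-!
# Route `KLProgramme` — crux K3 ENGINE (stmt-HubbardSuperconductivity-20437), stub (e) proof-input «(e)-D-ROWS», (M1)/F-D3′ (third part): THE GLUED TREE
# WEIGHT of the two-volume Lipschitz tower (definitions + rows; seat hubbard-kl-k3c4-p1 g23; `--supports` 20437; corrects DROWS-SCOPE-g22 §7.2's weight)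

The deep-pin doors (`…TwoVolumeLipDeepStep`, `…TwoVolumeLipDeepFirstOrder`) take ONE tree weight `wt` on the fine labels in which (a) the glued coarse input
`V = klGlue (klLipInput L …)` and (b) the fine input `V + D = klLipInput (bL) …` have weighted profiles, (c) the zone bracket is admissible (`Λ ≤ wt S` for `S`
joining a deep pin to the seam zone) and (d) the block covariance has weighted rows.  The fine torus's own weight `klScaleWt (bL)` FAILS (a): a coarse kernel
coupling two sites that are neighbours ACROSS the periodic boundary of the small torus becomes, glued into a box of the big torus, a kernel coupling two sites at
box distance `≈ L`, so the glued element has no profile in the fine weight uniformly in `L`.  The right weight is the GLUED weight — the coarse weight of the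
RESIDUES:

* §1 **`klResLabel L b M N X′ := (klBlockEquiv L b M N X′).2`** (the residue label) and **`klGluedWt L b M β J N S := klScaleWt L M β J ((S.image klResLabel).image latticeLegPos)`**
  (= `klLabelWt (klScaleWt L M β J) (S.image klResLabel)`); `isTreeWeight_klGluedWt` (pull-back of a tree weight);
* §2 (a) **`sum_pinned_wt_norm_kernel_klGlue_eq`** — in the glued weight the weighted pinned profile of `klGlue W` at a fine pin IS the `klScaleWt L`-weighted
  pinned profile of `W` at the residue pin (so the coarse law is the majorant of the glued coarse input, exactly);
* §3 (b) `torusSiteDist_res_le` (reduction `ℤ/bL → ℤ/L` does not increase torus distances), **`klGluedWt_le_klLabelWt_fine`** — `klGluedWt … S ≤ klLabelWt (klScaleWt (bL) M β J) S`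
  (so the fine law, stated in the fine weight, bounds the fine input's glued-weight profile);
* §4 (c) **`klGluedWt_ge_of_deep_of_not_deep`** — `1 + klScale klE0 J · (R′ + 1) ≤ klGluedWt … S` for `S` containing an `(R + R′)`-deep label and a label that is
  not `R`-deep (residue-level separation `…TwoVolumeTorusBlocks.succ_le_natAbs_cRepZ_sub_of_not_deep`) — the admissible constant of the zone bracket in the
  glued weight (twin of `…TwoVolumeLipZoneGeometry.klScaleWt_ge_of_deep_of_not_deep`, which is the fine-weight statement).

(d) follows from (b) for any covariance whose fine-weight rows are bounded.  Definitions with bodies + rows; nothing about the model is asserted; nothing asserts the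
(D) rows, stub (e), VL, K3 or superconductivity.  References: BGM 2006 §3 (3.2)–(3.8) [cite: BenfattoGiulianiMastropietro2006]; Salmhofer 1999 (2.102)–(2.106).
-/

noncomputable section

namespace Summit.HubbardSuperconductivity.HubbardSuperconductivity.Theorems.TwoVolumeLip

set_option linter.dupNamespace false -- summit = problem name (single-conjunct summit), D-0017

open Finset Literature.MathematicalPhysics.QuantumLattice GrassmannAlgebra Literature.Probability.LatticeModels
  Literature.Probability.LatticeModels.BattleFederbush
open Literature.MathematicalPhysics.QuantumLattice.FermiRG
open Summit.HubbardSuperconductivity.HubbardSuperconductivity.Theorems.KLRegimeSplit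
open Summit.HubbardSuperconductivity.HubbardSuperconductivity.Theorems.KLProgrammeLegKernels
open Summit.HubbardSuperconductivity.HubbardSuperconductivity.Theorems.DispersionFlow
open Summit.HubbardSuperconductivity.HubbardSuperconductivity.Theorems.EngineV8
open Summit.HubbardSuperconductivity.HubbardSuperconductivity.Theorems.TwoVolumeSource
open Summit.HubbardSuperconductivity.HubbardSuperconductivity.Theorems.TwoVolumeDefect

/-! ## §1 The residue label and the glued weight -/

section Defs

variable (L b M : ℕ) [NeZero L] [NeZero (b * L)]

/-- **`klResLabel L b M N X′`** — the RESIDUE label of a fine label: its label inside its block under the canonical block structure, `(klBlockEquiv L b M N X′).2`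
(time and sector unchanged, site reduced modulo `L`). -/
def klResLabel (N : ℕ) (X' : SpaceTimeIdx (b * L) M × SectorLeg N) : SpaceTimeIdx L M × SectorLeg N :=
  (klBlockEquiv L b M N X').2

/-- **`klGluedWt L b M β J N S`** — the GLUED tree weight at scale `J` of a set of fine labels: E1's coarse scale weight of the residues,
`klScaleWt L M β J ((S.image klResLabel).image latticeLegPos)`. -/
def klGluedWt (β : ℝ) (J N : ℕ) (S : Finset (SpaceTimeIdx (b * L) M × SectorLeg N)) : ℝ :=
  klLabelWt (klScaleWt L M β J) (S.image (klResLabel L b M N))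

variable {L b M}

/-- The residue label, explicitly: `((x₀, x⃗ mod L), ℓ)`. -/
theorem klResLabel_eq (N : ℕ) (X' : SpaceTimeIdx (b * L) M × SectorLeg N) :
    klResLabel L b M N X' = ((X'.1.1, fun i => (((X'.1.2 i).val : ℕ) : ZMod L)), X'.2) :=
  klBlockEquiv_snd L b M N X'

/-- The residue of an embedded label is the label. -/
theorem klResLabel_symm_apply (N : ℕ) (blk : Fin 2 → Fin b) (Y : SpaceTimeIdx L M × SectorLeg N) :
    klResLabel L b M N ((klBlockEquiv L b M N).symm (blk, Y)) = Y := by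
  rw [klResLabel, Equiv.apply_symm_apply]

/-- Unfolding `klGluedWt`. -/
theorem klGluedWt_apply (β : ℝ) (J N : ℕ) (S : Finset (SpaceTimeIdx (b * L) M × SectorLeg N)) :
    klGluedWt L b M β J N S = klScaleWt L M β J ((S.image (klResLabel L b M N)).image (latticeLegPos (2 * (2 * M)))) := rfl

/-- **The glued weight is a tree weight** (`0 ≤ β`; pull-back of E1's `klScaleWt L` along `latticeLegPos ∘ klResLabel`). -/
theorem isTreeWeight_klGluedWt [NeZero M] {β : ℝ} (hβ : 0 ≤ β) (J N : ℕ) : IsTreeWeight (klGluedWt L b M β J N) :=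
  (isTreeWeight_klLabelWt_klScaleWt (V := L) (M := M) (N := N) hβ J).comap (klResLabel L b M N)

/-- The glued weight is at least `1`. -/
theorem one_le_klGluedWt (β : ℝ) (J N : ℕ) (S : Finset (SpaceTimeIdx (b * L) M × SectorLeg N)) : 1 ≤ klGluedWt L b M β J N S :=
  one_le_klScaleWt L M β J _

end Defs

/-! ## §2 (a) The glued coarse input: its glued-weight profile is the coarse weighted profile -/

section GlueProfile

variable {L b M : ℕ} [NeZero L] [NeZero (b * L)]

/-- **In the glued weight, the weighted pinned profile of `klGlue W` at a fine pin is the `klScaleWt L`-weighted pinned profile of `W` at the residue pin**: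
`Σ_{Y′ : Y′_j = x′} ‖kernel (klGlue W) m Y′‖ · klGluedWt (im Y′) = Σ_{Y : Y_j = res x′} ‖kernel W m Y‖ · klLabelWt (klScaleWt L … J) (im Y)` — so E1's weighted law
of the coarse volume (`sum_wt_norm_kernel_klLipInput_le`) is, verbatim, the majorant `N_V` of the glued coarse input. -/
theorem sum_pinned_wt_norm_kernel_klGlue_eq (β : ℝ) (J : ℕ) {N : ℕ} (W : GrassmannAlgebra ℂ (SpaceTimeIdx L M × SectorLeg N)) {m : ℕ} (j : Fin m)
    (x' : SpaceTimeIdx (b * L) M × SectorLeg N) :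
    ∑ Y' ∈ univ.filter (fun Y' : Fin m → SpaceTimeIdx (b * L) M × SectorLeg N => Y' j = x'),
        ‖kernel ℂ (klGlue L b M N W) m Y'‖ * klGluedWt L b M β J N (univ.image Y') =
      ∑ Y ∈ univ.filter (fun Y : Fin m → SpaceTimeIdx L M × SectorLeg N => Y j = klResLabel L b M N x'),
        ‖kernel ℂ W m Y‖ * klLabelWt (klScaleWt L M β J) (univ.image Y) := by
  classical
  rw [klGlue_def, sum_pinned_kernel_copies_sum (klBlockEquiv L b M N) (klBlockEmb L b M N) klBlockEmb_apply W j x'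
    (fun Y' k => ‖k‖ * klGluedWt L b M β J N (univ.image Y')) (fun Y' => by rw [norm_zero, zero_mul])]
  refine sum_congr rfl fun Y _ => ?_
  congr 1
  rw [klGluedWt, image_image]
  congr 1
  refine Finset.ext fun Z => ?_
  simp only [mem_image, mem_univ, true_and, Function.comp_apply, klResLabel_symm_apply]

end GlueProfile

/-! ## §3 (b) The glued weight is dominated by the fine weight -/

section Fine

variable {L b M : ℕ} [NeZero L] [NeZero (b * L)]

/-- **Reduction `ℤ/bL → ℤ/L` does not increase torus distances** (coordinatewise `…TwoVolumeTorusBlocks.natAbs_cRepZ_red_le`). -/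
theorem torusSiteDist_res_le (x y : TorusSite 2 (b * L)) :
    torusSiteDist (fun i => ((((x i).val : ℕ)) : ZMod L)) (fun i => ((((y i).val : ℕ)) : ZMod L)) ≤ torusSiteDist x y := by
  rw [← tnorm_sub_eq_torusSiteDist, ← tnorm_sub_eq_torusSiteDist]
  have hdvd : L ∣ b * L := ⟨b, by ring⟩
  have h : Torus.tnorm ((fun i => ((((x i).val : ℕ)) : ZMod L)) - fun i => ((((y i).val : ℕ)) : ZMod L)) ≤ Torus.tnorm (x - y) := by
    rw [Torus.tnorm, Site.supNorm_le_iff]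
    intro i
    have hred : ((fun i => ((((x i).val : ℕ)) : ZMod L)) - fun i => ((((y i).val : ℕ)) : ZMod L)) i = ((((x - y) i).val : ℕ) : ZMod L) := by
      simp only [Pi.sub_apply]
      rw [← ZMod.cast_eq_val, ← ZMod.cast_eq_val, ← ZMod.cast_eq_val, ← ZMod.castHom_apply (h := hdvd), ← ZMod.castHom_apply (h := hdvd),
        ← ZMod.castHom_apply (h := hdvd), map_sub]
    rw [Torus.cRep, hred]
    exact (natAbs_cRepZ_red_le (M := b * L) (m := L) rfl ((x - y) i)).trans (natAbs_cRepZ_apply_le_tnorm (x - y) i)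
  exact_mod_cast h

/-- The grid label distance of the residues is at most that of the labels (`0 ≤ β`): same time coordinates, reduced sites. -/
theorem gridLabelDist_res_le (β : ℝ) {N : ℕ} (X' Y' : SpaceTimeIdx (b * L) M × SectorLeg N) :
    gridLabelDist L (2 * (2 * M)) β (latticeLegPos (2 * (2 * M)) (klResLabel L b M N X')) (latticeLegPos (2 * (2 * M)) (klResLabel L b M N Y')) ≤
      gridLabelDist (b * L) (2 * (2 * M)) β (latticeLegPos (2 * (2 * M)) X') (latticeLegPos (2 * (2 * M)) Y') := by
  rw [klResLabel_eq, klResLabel_eq, gridLabelDist_apply, gridLabelDist_apply]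
  simp only [latticeLegPos]
  have h := torusSiteDist_res_le (L := L) (b := b) X'.1.2 Y'.1.2
  linarith

/-- **THE GLUED WEIGHT IS DOMINATED BY THE FINE WEIGHT**: `klGluedWt L b M β J N S ≤ klLabelWt (klScaleWt (bL) M β J) S` — so a profile in the fine torus's own
scale weight (E1's law of the fine volume) is a profile in the glued weight. -/
theorem klGluedWt_le_klLabelWt_fine (β : ℝ) (J : ℕ) {N : ℕ} (S : Finset (SpaceTimeIdx (b * L) M × SectorLeg N)) :
    klGluedWt L b M β J N S ≤ klLabelWt (klScaleWt (b * L) M β J) S := by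
  rw [klGluedWt_apply, klLabelWt_apply, klScaleWt_apply, klScaleWt_apply]
  have hΛ : 0 ≤ klScale klE0 J := (klth_klScale_pos J).le
  have hd : labelDiam (gridLabelDist L (2 * (2 * M)) β) ((S.image (klResLabel L b M N)).image (latticeLegPos (2 * (2 * M)))) ≤
      labelDiam (gridLabelDist (b * L) (2 * (2 * M)) β) (S.image (latticeLegPos (2 * (2 * M)))) := by
    refine labelDiam_le _ (labelDiam_nonneg _ _) fun a ha c hc => ?_
    obtain ⟨a₁, ha₁, rfl⟩ := mem_image.1 ha
    obtain ⟨X', hX', rfl⟩ := mem_image.1 ha₁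
    obtain ⟨c₁, hc₁, rfl⟩ := mem_image.1 hc
    obtain ⟨Y', hY', rfl⟩ := mem_image.1 hc₁
    exact (gridLabelDist_res_le β X' Y').trans (le_labelDiam _ (mem_image_of_mem _ hX') (mem_image_of_mem _ hY'))
  have := mul_le_mul_of_nonneg_left hd hΛ
  linarith

/-- Hence a fine-weight profile bound is a glued-weight profile bound (termwise, for nonnegative coefficients). -/
theorem sum_mul_klGluedWt_le_of_fine (β : ℝ) (J : ℕ) {N m : ℕ} (s : Finset (Fin m → SpaceTimeIdx (b * L) M × SectorLeg N))
    (c : (Fin m → SpaceTimeIdx (b * L) M × SectorLeg N) → ℝ) (hc : ∀ Y' ∈ s, 0 ≤ c Y') {B : ℝ}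
    (hB : ∑ Y' ∈ s, c Y' * klLabelWt (klScaleWt (b * L) M β J) (univ.image Y') ≤ B) :
    ∑ Y' ∈ s, c Y' * klGluedWt L b M β J N (univ.image Y') ≤ B :=
  (sum_le_sum fun Y' hY' => mul_le_mul_of_nonneg_left (klGluedWt_le_klLabelWt_fine β J _) (hc Y' hY')).trans hB

end Fine

/-! ## §4 (c) The admissible constant of the zone bracket in the glued weight -/

section Zone

variable {L b M : ℕ} [NeZero L] [NeZero (b * L)]

omit [NeZero (b * L)] in
/-- Residue sites: the torus distance on `ℤ/L` between the residues of a site that is NOT `R`-deep and one that is `(R + R′)`-deep is `≥ R′ + 1`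
(coordinatewise `…TwoVolumeTorusBlocks.succ_le_natAbs_cRepZ_sub_of_not_deep`). -/
theorem succ_le_torusSiteDist_res_of_not_deep_of_deep {R R' : ℕ} {z a : TorusSite 2 (b * L)}
    (hz : ¬ ∀ j, R ≤ (z j).val % L ∧ (z j).val % L + R < L) (ha : ∀ j, R + R' ≤ (a j).val % L ∧ (a j).val % L + (R + R') < L) :
    (R' : ℝ) + 1 ≤ torusSiteDist (fun i => ((((z i).val : ℕ)) : ZMod L)) (fun i => ((((a i).val : ℕ)) : ZMod L)) := by
  obtain ⟨j, hj⟩ := not_forall.1 hz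
  have hu : ¬ (R ≤ (((((z j).val : ℕ)) : ZMod L)).val ∧ (((((z j).val : ℕ)) : ZMod L)).val + R < L) := by
    rw [ZMod.val_natCast]; exact hj
  have hv : R + R' ≤ (((((a j).val : ℕ)) : ZMod L)).val ∧ (((((a j).val : ℕ)) : ZMod L)).val + (R + R') < L := by
    rw [ZMod.val_natCast]; exact ha j
  have h1 : R' + 1 ≤ (Torus.cRepZ ((((((z j).val : ℕ)) : ZMod L)) - ((((a j).val : ℕ)) : ZMod L))).natAbs :=
    succ_le_natAbs_cRepZ_sub_of_not_deep hu hv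
  have h2 := natAbs_cRepZ_apply_le_tnorm ((fun i => ((((z i).val : ℕ)) : ZMod L)) - fun i => ((((a i).val : ℕ)) : ZMod L)) j
  have h3 : R' + 1 ≤ Torus.tnorm ((fun i => ((((z i).val : ℕ)) : ZMod L)) - fun i => ((((a i).val : ℕ)) : ZMod L)) := h1.trans h2
  have h4 : ((R' + 1 : ℕ) : ℝ) ≤ (Torus.tnorm ((fun i => ((((z i).val : ℕ)) : ZMod L)) - fun i => ((((a i).val : ℕ)) : ZMod L)) : ℝ) :=
    Nat.cast_le.2 h3
  rw [tnorm_sub_eq_torusSiteDist] at h4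
  push_cast at h4
  exact h4

/-- The site of the residue label is the reduced site. -/
theorem klResLabel_site (N : ℕ) (X' : SpaceTimeIdx (b * L) M × SectorLeg N) :
    (klResLabel L b M N X').1.2 = fun i => ((((X'.1.2 i).val : ℕ)) : ZMod L) := by
  rw [klResLabel_eq]

omit [NeZero L] [NeZero (b * L)] in
/-- The site of a lattice leg position is the site of the label (`rfl`). -/
theorem latticeLegPos_snd {V N : ℕ} (Ng : ℕ) (Y : SpaceTimeIdx V M × SectorLeg N) : (latticeLegPos Ng Y).2 = Y.1.2 := rfl

/-- **THE ADMISSIBLE CONSTANT OF THE ZONE BRACKET IN THE GLUED WEIGHT** (`0 ≤ β`): for a set `S` of fine labels containing a label `a′` whose site is `(R + R′)`-deep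
in its box and a label `z′` whose site is NOT `R`-deep, `1 + klScale klE0 J · (R′ + 1) ≤ klGluedWt L b M β J N S`.  With `R = r_k`, `R′ = ρ_k`, `J` the
measuring scale of block `k` this is the `Λ` of the deep-pin doors at block `k`. -/
theorem klGluedWt_ge_of_deep_of_not_deep {β : ℝ} (hβ : 0 ≤ β) (J : ℕ) {N R R' : ℕ} {S : Finset (SpaceTimeIdx (b * L) M × SectorLeg N)}
    {a' z' : SpaceTimeIdx (b * L) M × SectorLeg N} (ha : a' ∈ S) (hz : z' ∈ S) (ha' : a' ∈ klDeepPins L (R + R')) (hz' : z' ∉ klDeepPins L R) :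
    1 + klScale klE0 J * ((R' : ℝ) + 1) ≤ klGluedWt L b M β J N S := by
  rw [klGluedWt_apply, klScaleWt_apply]
  rw [mem_klDeepPins] at ha' hz'
  have hΛ : 0 ≤ klScale klE0 J := (klth_klScale_pos J).le
  have hsep : (R' : ℝ) + 1 ≤ torusSiteDist (klResLabel L b M N z').1.2 (klResLabel L b M N a').1.2 := by
    rw [klResLabel_site, klResLabel_site]
    exact succ_le_torusSiteDist_res_of_not_deep_of_deep hz' ha'
  have h0 := torusSiteDist_le_gridLabelDist hβ (latticeLegPos (2 * (2 * M)) (klResLabel L b M N z')) (latticeLegPos (2 * (2 * M)) (klResLabel L b M N a'))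
  rw [latticeLegPos_snd, latticeLegPos_snd] at h0
  have hzd : (R' : ℝ) + 1 ≤ gridLabelDist L (2 * (2 * M)) β (latticeLegPos (2 * (2 * M)) (klResLabel L b M N z'))
      (latticeLegPos (2 * (2 * M)) (klResLabel L b M N a')) := hsep.trans h0
  have hd : (R' : ℝ) + 1 ≤ labelDiam (gridLabelDist L (2 * (2 * M)) β)
      (((S.image (klResLabel L b M N)).image (latticeLegPos (2 * (2 * M))))) :=
    hzd.trans (le_labelDiam _ (mem_image_of_mem _ (mem_image_of_mem _ hz)) (mem_image_of_mem _ (mem_image_of_mem _ ha)))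
  have := mul_le_mul_of_nonneg_left hd hΛ
  linarith

end Zone

end Summit.HubbardSuperconductivity.HubbardSuperconductivity.Theorems.TwoVolumeLip

end
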